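import Summits.CriticalPhenomena.CardyFormulaZ2.Theorems.CardyRotToConfR2SymmetryUpgrade.Negative.SurgFatChord
import Summits.CriticalPhenomena.CardyFormulaZ2.Theorems.CardyRotToConfR2SymmetryUpgradeBranchComponents
import HarnessLib

/-!
# The fat example domain fires, its chord lands at `b`, and no segment-free family charges the chord
# (stub `stub_fatSurgeryWitness`, line `germ-label-transport`, crux `stmt-CriticalPhenomena-0698`)

Stub `stub_fatSurgeryWitness` of the lead's skeleton
(`Cruxes/CardyRotToConfR2SymmetryUpgrade/GermLabelTransport`, item S7f.5) for the fat-germ one-shot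
surgery against
`Summit.CriticalPhenomena.CardyFormulaZ2.Theses.CardyRotToConf.CardyRotToConfR2SymmetryUpgrade`.

The hypothesis is the conclusion of the sibling stub `stub_fatDomain`: an example Dobrushin domain
`(D; 0, -2i)` whose two boundary branches at `0` have positive area in every parameter
neighbourhood of the mark, which contains the lower half-disc near `0`, misses real points `±x`
and some upper-half-plane point arbitrarily close to `0`, and contains the open vertical segment
`{-ti : 0 < t < 2}`. For THAT domain we prove:

* `Negative.Fires D.carrier (D.pt 0)` (`fires_of`). FAT ON BOTH SIDES: for a radius `r` below
  `ε` and below `dist b a`, `stub_branchComponents` gives the two branch components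
  `Pf = ∂D(m₀, m₀ + δ₁)`, `Pb = ∂D(m₀ - δ₂, m₀)` of the punctured boundary
  `branchSet D a r`; they are distinct (injectivity of the boundary loop on a period), accumulate
  at `a` (continuity), and every component accumulating at `a` is one of them, hence of positive
  area (hypothesis), hence contained in no null set. HALF-DISC: the lower half-disc clause is
  `HalfDiscAt D 0 (-I)` (`rIP w (-I) = -im w`). UNIQUENESS of the unit normal: `re n > 0` (resp.
  `< 0`) would put the small real points `x` (resp. `-x`) in `D`; `re n = 0, im n = 1` would put
  the small upper-half-plane points in `D`; so `n = -I`.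
* `Negative.firePt D = D.pt 1` (`firePt_eq_pt_one`): the firing direction is `-I`, the ray points
  are `-tI`, in `D` for `0 < t < 2` and equal to `b = -2i ∈ ∂D ∌` carrier points at `t = 2`, so
  the exit parameter (an infimum) is `2`.
* No segment-free family `S` has `S D = δ_{[chord]}` (`dirac_fireChord_ne`): the a.e. "no traced
  segment" clause for `δ_{[chord]}` holds AT the chord class (`ae_dirac_eq`, curve classes form a
  metric space with its Borel σ-algebra), and tested on the representative `fireChord D` with
  `s = 0, t = 1` it says the (collinear) chord trace is one point, whereas it contains `a ≠ q`.

References: W. Werner, *Lectures on two-dimensional critical percolation* (2007), §3.2 (chordal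
families); the statements are folklore planar topology. Mathlib anchors: `connectedComponentIn`,
`MeasureTheory.ae_dirac_eq`, `Filter.eventually_pure`, `collinear_iff_exists_forall_eq_smul_vadd`,
`csInf_le` / `le_csInf`.
-/

noncomputable section

open Set Filter Topology Metric MeasureTheory
open scoped unitInterval

namespace Summit.CriticalPhenomena.CardyFormulaZ2.Theorems.CardyRotToConfR2SymmetryUpgrade

open Literature.Probability.RandomPlanarGeometry
open Summit.CriticalPhenomena.CardyFormulaZ2.Theorems.CardyRotToConfR2SymmetryUpgrade.Negative

namespace FatSurgeryWitness

variable {D : DobrushinDomain}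

/-! ### Fat on both sides: branch components of positive area -/

/-- **Positive-area branches are fat on both sides.** If both boundary branches of a Dobrushin
domain at its first mark have positive planar Lebesgue measure in every parameter neighbourhood
of the mark, the germ of the domain at `a = D.pt 0` is fat on both sides: by
`stub_branchComponents` the components of the punctured boundary accumulating at `a` are exactly
the two branches up to their first exits from the ball. [folklore] -/
theorem fatBothSides_of_volume_pos
    (hvol : ∀ ε : ℝ, 0 < ε → 0 < volume (D.boundary '' Ioo (D.mark 0) (D.mark 0 + ε)) ∧
      0 < volume (D.boundary '' Ioo (D.mark 0 - ε) (D.mark 0))) :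
    FatBothSides D.carrier (D.pt 0) := by
  intro ε hε
  -- a radius below `ε` and below `dist b a`, so that `b = D.boundary (D.mark 1)` is off the ball
  have hd : 0 < dist (D.pt 1) (D.pt 0) :=
    dist_pos.2 fun h => absurd (D.pt_injective h) (by decide)
  set r : ℝ := min (ε / 2) (dist (D.pt 1) (D.pt 0)) with hr
  have hr0 : 0 < r := lt_min (half_pos hε) hd
  have hrε : r < ε := (min_le_left _ _).trans_lt (half_lt_self hε)
  have hout : ∃ t : ℝ, D.boundary t ∉ ball (D.boundary (D.mark 0)) r := by
    refine ⟨D.mark 1, fun h => ?_⟩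
    have h' : dist (D.pt 1) (D.pt 0) < r := mem_ball.1 h
    exact not_le.2 h' (min_le_right _ _)
  obtain ⟨δ₁, δ₂, hδ₁, hδ₂, h12, -, -, hC₁, hC₂, hacc⟩ :=
    stub_branchComponents D.toJordanDomain (D.mark 0) r hr0 hout
  set m₀ : ℝ := D.mark 0 with hm₀
  set Pf : Set ℂ := D.boundary '' Ioo m₀ (m₀ + δ₁) with hPf
  set Pb : Set ℂ := D.boundary '' Ioo (m₀ - δ₂) m₀ with hPb
  set B : Set ℂ := branchSet D.carrier (D.pt 0) r with hB
  -- one point on each branch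
  have hx : D.boundary (m₀ + δ₁ / 2) ∈ Pf := ⟨m₀ + δ₁ / 2, ⟨by linarith, by linarith⟩, rfl⟩
  have hy : D.boundary (m₀ - δ₂ / 2) ∈ Pb := ⟨m₀ - δ₂ / 2, ⟨by linarith, by linarith⟩, rfl⟩
  have hCx : connectedComponentIn B (D.boundary (m₀ + δ₁ / 2)) = Pf := hC₁ _ hx
  have hCy : connectedComponentIn B (D.boundary (m₀ - δ₂ / 2)) = Pb := hC₂ _ hy
  have hxB : D.boundary (m₀ + δ₁ / 2) ∈ B :=
    connectedComponentIn_nonempty_iff.1 (by rw [hCx]; exact ⟨_, hx⟩)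
  have hyB : D.boundary (m₀ - δ₂ / 2) ∈ B :=
    connectedComponentIn_nonempty_iff.1 (by rw [hCy]; exact ⟨_, hy⟩)
  -- the two branches are distinct: injectivity of the boundary loop on the period from `m₀ - δ₂`
  have hne : Pf ≠ Pb := by
    intro heq
    have hx' : D.boundary (m₀ + δ₁ / 2) ∈ Pb := heq ▸ hx
    obtain ⟨u, hu, hux⟩ := hx'
    have hinj := D.injOn_boundary_Ico (m₀ - δ₂) ⟨hu.1.le, by linarith [hu.2]⟩
      ⟨by linarith, by linarith⟩ hux
    linarith [hu.2]
  -- `a` is in the closure of each branch (continuity of the boundary loop at `m₀`)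
  have hγ := D.continuous_boundary
  have hclf : D.pt 0 ∈ closure Pf := by
    have htend : Tendsto D.boundary (𝓝[>] m₀) (𝓝 (D.boundary m₀)) :=
      hγ.continuousAt.tendsto.mono_left nhdsWithin_le_nhds
    refine mem_closure_of_tendsto htend ?_
    filter_upwards [Ioo_mem_nhdsGT (show m₀ < m₀ + δ₁ by linarith)] with t ht
    exact mem_image_of_mem _ ht
  have hclb : D.pt 0 ∈ closure Pb := by
    have htend : Tendsto D.boundary (𝓝[<] m₀) (𝓝 (D.boundary m₀)) :=
      hγ.continuousAt.tendsto.mono_left nhdsWithin_le_nhds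
    refine mem_closure_of_tendsto htend ?_
    filter_upwards [Ioo_mem_nhdsLT (show m₀ - δ₂ < m₀ by linarith)] with t ht
    exact mem_image_of_mem _ ht
  refine ⟨r, ⟨hr0, hrε⟩, ⟨_, hxB, _, hyB, ?_, ?_, ?_⟩, ?_⟩
  · rwa [hCx, hCy]
  · rwa [hCx]
  · rwa [hCy]
  · -- every component accumulating at `a` is a branch, of positive area
    intro z hz hza N hN hsub
    rcases hacc z hz hza with hzf | hzb
    · have h0 : volume Pf = 0 := measure_mono_null (by rw [← hzf]; exact hsub) hN
      exact (hvol δ₁ hδ₁).1.ne' h0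
    · have h0 : volume Pb = 0 := measure_mono_null (by rw [← hzb]; exact hsub) hN
      exact (hvol δ₂ hδ₂).2.ne' h0

/-! ### The half-disc and the uniqueness of its normal -/

/-- The lower half-disc clause at `a = 0` is `HalfDiscAt D 0 (-I)` (`⟨w, -I⟩ = -im w`).
[folklore] -/
theorem halfDiscAt_neg_I (h0 : D.pt 0 = 0) {ρ : ℝ} (hρ : 0 < ρ)
    (hhalf : ∀ w : ℂ, ‖w‖ < ρ → w.im < 0 → w ∈ D.carrier) :
    HalfDiscAt D.carrier (D.pt 0) (-Complex.I) := by
  refine ⟨ρ, hρ, fun w hw hip => hhalf w ?_ ?_⟩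
  · rwa [h0, dist_zero_right] at hw
  · rw [h0, sub_zero, rIP_eq] at hip
    simp only [Complex.neg_re, Complex.I_re, neg_zero, mul_zero, Complex.neg_im, Complex.I_im,
      mul_neg, mul_one, zero_add, Left.neg_pos_iff] at hip
    exact hip

/-- **Uniqueness of the half-disc normal.** If `D` misses real points `±x` and upper-half-plane
points arbitrarily close to `a = 0`, the only unit vector `n` with `HalfDiscAt D 0 n` is `-I`.
[folklore] -/
theorem eq_neg_I_of_halfDiscAt (h0 : D.pt 0 = 0)
    (hreal : ∀ r : ℝ, 0 < r → ∃ x : ℝ, 0 < x ∧ x < r ∧ (x : ℂ) ∉ D.carrier ∧ (-(x : ℂ)) ∉ D.carrier)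
    (hupper : ∀ r : ℝ, 0 < r → ∃ w : ℂ, ‖w‖ < r ∧ 0 < w.im ∧ w ∉ D.carrier)
    {n : ℂ} (hn : ‖n‖ = 1) (hU : HalfDiscAt D.carrier (D.pt 0) n) : n = -Complex.I := by
  obtain ⟨r, hr, hin⟩ := hU
  rw [h0] at hin
  have hin' : ∀ w : ℂ, ‖w‖ < r → 0 < w.re * n.re + w.im * n.im → w ∈ D.carrier :=
    fun w hw hip => hin w (by rwa [dist_zero_right]) (by rwa [sub_zero, rIP_eq])
  obtain ⟨x, hx0, hxr, hxD, hxD'⟩ := hreal r hr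
  have hxn : ‖(x : ℂ)‖ < r := by
    rw [Complex.norm_real, Real.norm_eq_abs, abs_of_pos hx0]; exact hxr
  -- the normal has no real part: otherwise `x` or `-x` lies in the half-disc
  have hre : n.re = 0 := by
    rcases lt_trichotomy n.re 0 with hlt | heq | hgt
    · refine absurd (hin' (-(x : ℂ)) (by rwa [norm_neg]) ?_) hxD'
      simp only [Complex.neg_re, Complex.ofReal_re, neg_mul, Complex.neg_im, Complex.ofReal_im,
        neg_zero, zero_mul, add_zero, Left.neg_pos_iff]
      exact mul_neg_of_pos_of_neg hx0 hlt
    · exact heq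
    · refine absurd (hin' (x : ℂ) hxn ?_) hxD
      simp only [Complex.ofReal_re, Complex.ofReal_im, zero_mul, add_zero]
      exact mul_pos hx0 hgt
  -- so `im n = ±1`, and `im n = 1` would put the upper half-disc in `D`
  have hsq : n.re * n.re + n.im * n.im = 1 := by
    rw [← Complex.normSq_apply, Complex.normSq_eq_norm_sq, hn, one_pow]
  rw [hre, mul_zero, zero_add] at hsq
  rcases mul_self_eq_one_iff.1 hsq with h1 | h1
  · exfalso
    obtain ⟨w, hw, hwim, hwD⟩ := hupper r hr
    refine hwD (hin' w hw ?_)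
    rw [hre, h1, mul_zero, zero_add, mul_one]
    exact hwim
  · exact Complex.ext (by rw [hre, Complex.neg_re, Complex.I_re, neg_zero])
      (by rw [h1, Complex.neg_im, Complex.I_im])

/-- **The example domain fires at `a = 0`.** [folklore] -/
theorem fires_of (h0 : D.pt 0 = 0)
    (hvol : ∀ ε : ℝ, 0 < ε → 0 < volume (D.boundary '' Ioo (D.mark 0) (D.mark 0 + ε)) ∧
      0 < volume (D.boundary '' Ioo (D.mark 0 - ε) (D.mark 0)))
    {ρ : ℝ} (hρ : 0 < ρ) (hhalf : ∀ w : ℂ, ‖w‖ < ρ → w.im < 0 → w ∈ D.carrier)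
    (hreal : ∀ r : ℝ, 0 < r → ∃ x : ℝ, 0 < x ∧ x < r ∧ (x : ℂ) ∉ D.carrier ∧ (-(x : ℂ)) ∉ D.carrier)
    (hupper : ∀ r : ℝ, 0 < r → ∃ w : ℂ, ‖w‖ < r ∧ 0 < w.im ∧ w ∉ D.carrier) :
    Fires D.carrier (D.pt 0) := by
  refine ⟨fatBothSides_of_volume_pos hvol, -Complex.I,
    ⟨by rw [norm_neg, Complex.norm_I], halfDiscAt_neg_I h0 hρ hhalf⟩, ?_⟩
  rintro n ⟨hn, hU⟩
  exact eq_neg_I_of_halfDiscAt h0 hreal hupper hn hU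

/-! ### The chord lands at `b = -2i` -/

/-- **The chord of the example domain lands at `b`.** With firing direction `-I` the ray points are
`-tI`; they lie in `D` for `0 < t < 2` and `-2i = b ∈ ∂D` is not in `D`, so the exit parameter is
`2` and the landing point is `b`. [folklore] -/
theorem firePt_eq_pt_one (h : Fires D.carrier (D.pt 0))
    (hdir : fireDir D.carrier (D.pt 0) = -Complex.I) (h0 : D.pt 0 = 0)
    (h1 : D.pt 1 = -2 * Complex.I)
    (hseg : ∀ t : ℝ, 0 < t → t < 2 → -((t : ℂ) * Complex.I) ∈ D.carrier) :
    firePt D = D.pt 1 := by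
  have hray : ∀ t : ℝ, rayPt (D.pt 0) (fireTip D) t = -((t : ℂ) * Complex.I) := fun t => by
    rw [rayPt_fireTip h, hdir, h0, zero_add, mul_neg]
  -- `2` is an exit parameter: the ray point is `b ∈ ∂D`, not in the open set `D`
  have h2 : (2 : ℝ) ∈ {t : ℝ | 0 < t ∧ rayPt (D.pt 0) (fireTip D) t ∉ D.carrier} := by
    refine ⟨two_pos, fun hmem => ?_⟩
    have hfr : D.pt 1 ∈ frontier D.carrier := D.pt_mem_frontier 1
    rw [D.isOpen.frontier_eq] at hfr
    refine hfr.2 ?_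
    rw [h1]
    convert hmem using 1
    rw [hray]
    push_cast
    ring
  -- and it is the least one: earlier ray points lie on the open vertical segment inside `D`
  have hexit : fireExit D = 2 := by
    show sInf {t : ℝ | 0 < t ∧ rayPt (D.pt 0) (fireTip D) t ∉ D.carrier} = 2
    refine le_antisymm (csInf_le ⟨0, fun s hs => hs.1.le⟩ h2) (le_csInf ⟨2, h2⟩ fun t ht => ?_)
    by_contra hlt
    rw [not_le] at hlt
    exact ht.2 (by rw [hray]; exact hseg t ht.1 hlt)
  rw [firePt, hexit, hray, h1]
  push_cast
  ring

/-! ### No segment-free family charges the chord class -/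

/-- **A segment-free law is not the Dirac mass at the chord.** If `S D`-a.e. class has no
representative tracing a non-degenerate straight segment, then `S D ≠ δ_{[fireChord D]}`: the
a.e. statement for a Dirac mass holds at its atom, and the chord itself (parameters `0 < 1`) is a
collinear, non-degenerate sub-arc. [folklore] -/
theorem dirac_fireChord_ne (h : Fires D.carrier (D.pt 0)) (S : ChordalFamily)
    (hS : ∀ D : DobrushinDomain, ∀ᵐ γ ∂(S D), ∀ c : Curve ℂ, CurveClass.mk c = γ →
      ∀ s t : I, s < t → Collinear ℝ (c '' Icc s t) → (c '' Icc s t).Subsingleton) :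
    S D ≠ Measure.dirac (CurveClass.mk (fireChord D)) := by
  intro heq
  have key : ∀ c : Curve ℂ, CurveClass.mk c = CurveClass.mk (fireChord D) →
      ∀ s t : I, s < t → Collinear ℝ (c '' Icc s t) → (c '' Icc s t).Subsingleton := by
    have hae := hS D
    rw [heq, ae_dirac_eq, Filter.eventually_pure] at hae
    exact hae
  have h01 : (0 : I) < 1 := unitInterval.lt_one_iff_ne_one.2 zero_ne_one
  have hcol : Collinear ℝ ((fireChord D) '' Icc (0 : I) 1) := by
    rw [collinear_iff_exists_forall_eq_smul_vadd]
    refine ⟨D.pt 0, dir (D.pt 0) (fireTip D), ?_⟩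
    rintro _ ⟨s, -, rfl⟩
    refine ⟨(s : ℝ) * fireExit D, ?_⟩
    rw [fireChord_apply, rayPt, vadd_eq_add, Complex.real_smul, add_comm]
  have hsub := key (fireChord D) rfl 0 1 h01 hcol
  have hmem0 : fireChord D 0 ∈ (fireChord D) '' Icc (0 : I) 1 :=
    mem_image_of_mem _ ⟨le_rfl, unitInterval.le_one'⟩
  have hmem1 : fireChord D 1 ∈ (fireChord D) '' Icc (0 : I) 1 :=
    mem_image_of_mem _ ⟨unitInterval.nonneg', le_rfl⟩
  have := hsub hmem0 hmem1
  rw [← Curve.source_def, ← Curve.target_def, source_fireChord, target_fireChord] at this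
  exact firePt_ne_pt_zero h this.symm

end FatSurgeryWitness

open FatSurgeryWitness in
/-- **S7f.5.** The fat example domain `(D; 0, -2i)` (conclusion of `stub_fatDomain`) fires at `0`,
its surgery chord lands at `b = -2i`, and no chordal family whose curves trace no straight segment
gives `D` the Dirac mass at the chord class. [folklore] -/
theorem stub_fatSurgeryWitness : (∃ D : DobrushinDomain, D.pt 0 = 0 ∧ D.pt 1 = -2 * Complex.I ∧ (∀ ε : ℝ, 0 < ε → 0 < MeasureTheory.volume (D.boundary '' Set.Ioo (D.mark 0) (D.mark 0 + ε)) ∧ 0 < MeasureTheory.volume (D.boundary '' Set.Ioo (D.mark 0 - ε) (D.mark 0))) ∧ (∃ r : ℝ, 0 < r ∧ ∀ w : ℂ, ‖w‖ < r → w.im < 0 → w ∈ D.carrier) ∧ (∀ r : ℝ, 0 < r → ∃ x : ℝ, 0 < x ∧ x < r ∧ (x : ℂ) ∉ D.carrier ∧ (-(x : ℂ)) ∉ D.carrier) ∧ (∀ r : ℝ, 0 < r → ∃ w : ℂ, ‖w‖ < r ∧ 0 < w.im ∧ w ∉ D.carrier) ∧ (∀ t : ℝ, 0 < t → t < 2 →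 -((t : ℂ) * Complex.I) ∈ D.carrier)) → ∃ D : DobrushinDomain, Summit.CriticalPhenomena.CardyFormulaZ2.Theorems.CardyRotToConfR2SymmetryUpgrade.Negative.Fires D.carrier (D.pt 0) ∧ Summit.CriticalPhenomena.CardyFormulaZ2.Theorems.CardyRotToConfR2SymmetryUpgrade.Negative.firePt D = D.pt 1 ∧ ∀ S : ChordalFamily, (∀ D : DobrushinDomain, ∀ᵐ γ ∂(S D), ∀ c : Curve ℂ, CurveClass.mk c = γ → ∀ s t : unitInterval, s < t → Collinear ℝ (c '' Set.Icc s t) → (c '' Set.Icc s t).Subsingleton) → S D ≠ MeasureTheory.Measure.dirac (CurveClass.mk (Summit.CriticalPhenomena.CardyFormulaZ2.Theorems.CardyRotToConfR2SymmetryUpgrade.Negative.fireChord D)) := by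
  rintro ⟨D, h0, h1, hvol, ⟨ρ, hρ, hhalf⟩, hreal, hupper, hseg⟩
  have hfire : Fires D.carrier (D.pt 0) := fires_of h0 hvol hρ hhalf hreal hupper
  have hdir : fireDir D.carrier (D.pt 0) = -Complex.I :=
    (hfire.eq_fireDir (by rw [norm_neg, Complex.norm_I]) (halfDiscAt_neg_I h0 hρ hhalf)).symm
  exact ⟨D, hfire, firePt_eq_pt_one hfire hdir h0 h1 hseg, fun S hS => dirac_fireChord_ne hfire S hS⟩

end Summit.CriticalPhenomena.CardyFormulaZ2.Theorems.CardyRotToConfR2SymmetryUpgrade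

end
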